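import Summits.Ventures.HodgeRepro2.WeilPlanes

/-!
# Monomials, contraction, and the top-degree integral of the twelve-plane model (A3, seat p5)

Continues `WeilPlanes.lean` (route/T4-A3-p5.md §A5.3–A5.6).  `H^*(B, ℂ) = ⋀^* H^1(B, ℂ)` is modelled
by `A ι = ExteriorAlgebra ℂ (Gen ι → ℂ)`; the wedge MONOMIALS `e_M` are `mono l` for lists `l` of
generator indices.  The integral `∫_B : H^{24}(B, ℂ) → ℂ` is modelled by `integral`, the iterated
contraction with the dual basis along a fixed enumeration of all generator indices followed by the
scalar part: it is `ℂ`-linear, vanishes on every monomial that is not a permutation of the full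
generator list, and takes a non-zero value `vol` on the top monomial `E_𝒫`.

Main results (kernel-checked): `mono_ne_zero_of_nodup` (a wedge of distinct generators is non-zero,
by contracting one generator at a time), `integral_mono_eq_zero` (the vanishing), `vol_ne_zero`,
and the exact-sign identity `mono_map_mul_mono_map` used for T4-A3 Lemma A5.6.
-/

namespace Summit.Ventures.HodgeRepro2.WeilIntegral

open Summit.Ventures.HodgeRepro2.WeilPlanes

variable {ι : Type*} [DecidableEq ι]

/-! ## 1. Monomials -/

/-- The wedge monomial of a list of generator indices: `mono [j₁, …, j_k] = gen j₁ ∧ ⋯ ∧ gen j_k`. -/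
noncomputable def mono (l : List (Gen ι)) : A ι := (l.map gen).prod

/-- `mono [] = 1`. -/
@[simp] theorem mono_nil : mono ([] : List (Gen ι)) = 1 := by simp [mono]

/-- `mono (j :: l) = gen j ∧ mono l`. -/
@[simp] theorem mono_cons (j : Gen ι) (l : List (Gen ι)) : mono (j :: l) = gen j * mono l := by
  simp [mono]

/-- `mono (l₁ ++ l₂) = mono l₁ ∧ mono l₂`. -/
theorem mono_append (l₁ l₂ : List (Gen ι)) : mono (l₁ ++ l₂) = mono l₁ * mono l₂ := by
  simp [mono]

/-- Moving a generator past a monomial of length `n` costs the sign `(−1)^n`. -/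
theorem gen_mul_mono_swap (j : Gen ι) (l : List (Gen ι)) :
    gen j * mono l = ((-1 : ℂ) ^ l.length) • (mono l * gen j) := by
  induction l with
  | nil => simp
  | cons k l ih =>
    rw [mono_cons, List.length_cons, ← mul_assoc, gen_mul_gen_swap j k, neg_mul, mul_assoc, ih,
      mul_smul_comm, pow_succ, mul_comm _ (-1 : ℂ), mul_smul, neg_one_smul, mul_assoc]

/-- A monomial with a repeated generator vanishes. -/
theorem mono_eq_zero_of_not_nodup {l : List (Gen ι)} (h : ¬ l.Nodup) : mono l = 0 := by
  induction l with
  | nil => exact absurd List.nodup_nil h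
  | cons j l ih =>
    rw [List.nodup_cons, not_and_or] at h
    rcases h with h | h
    · obtain ⟨l₁, l₂, rfl⟩ := List.append_of_mem (not_not.mp h)
      rw [mono_cons, mono_append, mono_cons, ← mul_assoc, gen_mul_mono_swap j l₁, smul_mul_assoc,
        mul_assoc, ← mul_assoc (gen j) (gen j), gen_mul_self, zero_mul, mul_zero, smul_zero]
    · rw [mono_cons, ih h, mul_zero]

/-- `E p ∧ mono l = 0` as soon as `l` contains a generator of the plane `p`. -/
theorem E_mul_mono_of_mem {p : ι} {c : Bool} {l : List (Gen ι)} (h : (p, c) ∈ l) :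
    E p * mono l = 0 := by
  obtain ⟨l₁, l₂, rfl⟩ := List.append_of_mem h
  rw [mono_append, mono_cons, ← mul_assoc, ← mul_assoc, (commute_E p (mono l₁)).eq, mul_assoc,
    mul_assoc, ← mul_assoc (E p), E_mul_gen, zero_mul, mul_zero]

/-- `E_T ∧ mono l = 0` as soon as `l` contains a generator of a plane of `T`. -/
theorem ET_mul_mono_of_mem {T : Finset ι} {p : ι} {c : Bool} {l : List (Gen ι)} (hp : p ∈ T)
    (h : (p, c) ∈ l) : ET T * mono l = 0 :=
  ET_mul_eq_zero_of_exists ⟨p, hp, E_mul_mono_of_mem h⟩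

/-- `E_T` as a monomial: the generator list of the planes of `T` (in the order of `T.toList`). -/
noncomputable def planeList (T : Finset ι) : List (Gen ι) := T.toList.flatMap fun p => [(p, false), (p, true)]

/-- `mono (L.flatMap f) = ∏ mono (f p)`. -/
theorem mono_flatMap (L : List ι) (f : ι → List (Gen ι)) :
    mono (L.flatMap f) = (L.map fun p => mono (f p)).prod := by
  induction L with
  | nil => simp
  | cons p L ih => rw [List.flatMap_cons, mono_append, ih, List.map_cons, List.prod_cons]

/-- `E_T = mono (planeList T)`. -/
theorem ET_eq_mono (T : Finset ι) : ET T = mono (planeList T) := by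
  unfold planeList
  rw [mono_flatMap]
  have h1 : ∀ p : ι, mono [(p, false), (p, true)] = E p := by
    intro p
    simp [E]
  simp only [h1]
  rw [ET, ← Finset.prod_map_toList]
  have : (((List.map Ec T.toList).prod : Subalgebra.center ℂ (A ι)) : A ι) =
      (Subalgebra.val _) (List.map Ec T.toList).prod := rfl
  rw [this, map_list_prod, List.map_map]
  rfl

omit [DecidableEq ι] in
/-- Membership in `planeList T`. -/
theorem mem_planeList {T : Finset ι} {j : Gen ι} : j ∈ planeList T ↔ j.1 ∈ T := by
  unfold planeList
  simp only [List.mem_flatMap, Finset.mem_toList, List.mem_cons, List.not_mem_nil, or_false]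
  constructor
  · rintro ⟨p, hp, h | h⟩ <;> subst h <;> exact hp
  · intro h
    refine ⟨j.1, h, ?_⟩
    rcases j with ⟨p, _ | _⟩ <;> simp

omit [DecidableEq ι] in
/-- `planeList T` has no repeated generator. -/
theorem nodup_planeList (T : Finset ι) : (planeList T).Nodup := by
  unfold planeList
  rw [List.nodup_flatMap]
  refine ⟨fun p _ => by simp, ?_⟩
  refine (Finset.nodup_toList T).imp fun {p q} hpq => ?_
  intro j hj hj'
  simp only [List.mem_cons, List.not_mem_nil, or_false] at hj hj'
  rcases hj with rfl | rfl <;> rcases hj' with h | h <;> exact hpq (Prod.mk.inj h).1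

/-! ## 2. Contraction by the dual basis; non-vanishing of monomials -/

/-- The dual basis vector `d_j : V → ℂ`, `v ↦ v j`. -/
def dual (j : Gen ι) : Module.Dual ℂ (V ι) := LinearMap.proj j

/-- `d_j (gen k) = δ_{jk}`. -/
theorem dual_single (j k : Gen ι) :
    dual j (Pi.single k (1 : ℂ) : V ι) = if j = k then 1 else 0 := by
  simp [dual, Pi.single_apply]

/-- Left contraction `d ⌋ x` (Mathlib's `CliffordAlgebra.contractLeft` for the zero form). -/
noncomputable def contr (d : Module.Dual ℂ (V ι)) : A ι →ₗ[ℂ] A ι :=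
  CliffordAlgebra.contractLeft (Q := (0 : QuadraticForm ℂ (V ι))) d

/-- `d ⌋ (gen j ∧ x) = d(gen j)·x − gen j ∧ (d ⌋ x)` (the contraction is a derivation). -/
theorem contr_gen_mul (d : Module.Dual ℂ (V ι)) (j : Gen ι) (x : A ι) :
    contr d (gen j * x) = d (Pi.single j (1 : ℂ) : V ι) • x - gen j * contr d x :=
  CliffordAlgebra.contractLeft_ι_mul d _ x

omit [DecidableEq ι] in
/-- `d ⌋ 1 = 0`. -/
theorem contr_one (d : Module.Dual ℂ (V ι)) : contr d (1 : A ι) = 0 :=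
  CliffordAlgebra.contractLeft_one _ d

/-- `d_j ⌋ mono l = 0` when `j` does not occur in `l`. -/
theorem contr_dual_mono_of_notMem {j : Gen ι} {l : List (Gen ι)} (h : j ∉ l) :
    contr (dual j) (mono l) = 0 := by
  induction l with
  | nil => simp [contr_one]
  | cons k l ih =>
    have hjk : j ≠ k := fun h' => h (h' ▸ List.mem_cons_self ..)
    rw [mono_cons, contr_gen_mul, dual_single, if_neg hjk, zero_smul, zero_sub,
      ih (fun h' => h (List.mem_cons_of_mem k h')), mul_zero, neg_zero]

/-- `d_j ⌋ mono l = ± mono (l.erase j)` when `j` occurs in the repetition-free list `l`. -/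
theorem contr_dual_mono_of_mem {j : Gen ι} {l : List (Gen ι)} (hl : l.Nodup) (hj : j ∈ l) :
    ∃ ε : ℂ, (ε = 1 ∨ ε = -1) ∧ contr (dual j) (mono l) = ε • mono (l.erase j) := by
  induction l with
  | nil => exact absurd hj (List.not_mem_nil)
  | cons k l ih =>
    rw [List.nodup_cons] at hl
    by_cases hjk : j = k
    · subst hjk
      refine ⟨1, Or.inl rfl, ?_⟩
      rw [mono_cons, contr_gen_mul, dual_single, if_pos rfl, contr_dual_mono_of_notMem hl.1,
        mul_zero, sub_zero, List.erase_cons_head]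
    · have hj' : j ∈ l := (List.mem_cons.mp hj).resolve_left hjk
      obtain ⟨ε, hε, h⟩ := ih hl.2 hj'
      refine ⟨-ε, ?_, ?_⟩
      · rcases hε with rfl | rfl
        · exact Or.inr rfl
        · exact Or.inl (neg_neg 1)
      · have hkj : ¬ ((k == j) = true) := by simpa using Ne.symm hjk
        rw [mono_cons, contr_gen_mul, dual_single, if_neg hjk, zero_smul, zero_sub, h,
          List.erase_cons_tail hkj, mono_cons, mul_smul_comm, neg_smul]

/-- A wedge of distinct generators is non-zero (T4-A3 (A5.3)(c); used for `E_{I_σ} ∧ w_σ ≠ 0` in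
Lemma A5.4): contract one generator at a time. -/
theorem mono_ne_zero_of_nodup {l : List (Gen ι)} (hl : l.Nodup) : mono l ≠ 0 := by
  induction l with
  | nil => simp
  | cons j l ih =>
    rw [List.nodup_cons] at hl
    intro h0
    have h1 := contr_dual_mono_of_notMem (j := j) hl.1
    have h2 : contr (dual j) (mono (j :: l)) = mono l := by
      rw [mono_cons, contr_gen_mul, dual_single, if_pos rfl, one_smul, h1, mul_zero, sub_zero]
    exact ih hl.2 (by rw [← h2, h0, map_zero])

/-! ## 3. The integral -/

section Integral

variable [Fintype ι]

/-- The fixed enumeration of all generator indices (the generator list of `E_𝒫`). -/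
noncomputable def genList : List (Gen ι) := planeList (Finset.univ : Finset ι)

/-- Iterated contraction along a list of generator indices (first element applied first). -/
noncomputable def contrList : List (Gen ι) → A ι →ₗ[ℂ] A ι
  | [] => LinearMap.id
  | j :: L => contrList L ∘ₗ contr (dual j)

/-- The model of `∫_B : H^*(B, ℂ) → ℂ`: contract with every dual basis vector, then take the
scalar part.  It is `ℂ`-linear, vanishes on every monomial that is not a permutation of the full
generator list (`integral_mono_eq_zero`), and is `±1` on those (`integral_mono_of_forall_mem`). -/
noncomputable def integral : A ι →ₗ[ℂ] ℂ :=
  (ExteriorAlgebra.algebraMapInv (R := ℂ) (M := V ι)).toLinearMap ∘ₗ contrList genList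

omit [Fintype ι] in
/-- Iterated contraction of a monomial along `L ⊆ l` (both repetition-free) removes the
generators of `L`, up to sign. -/
theorem contrList_mono_of_subset (L : List (Gen ι)) :
    ∀ l : List (Gen ι), L.Nodup → l.Nodup → (∀ j ∈ L, j ∈ l) →
      ∃ ε : ℂ, (ε = 1 ∨ ε = -1) ∧
        contrList L (mono l) = ε • mono (l.filter fun k => decide (k ∉ L)) := by
  induction L with
  | nil =>
    intro l _ _ _
    refine ⟨1, Or.inl rfl, ?_⟩
    simp [contrList]
  | cons j L ih =>
    intro l hL hl hsub
    rw [List.nodup_cons] at hL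
    obtain ⟨ε₁, hε₁, h₁⟩ := contr_dual_mono_of_mem hl (hsub j (List.mem_cons_self ..))
    have hsub' : ∀ k ∈ L, k ∈ l.erase j := fun k hk =>
      (List.mem_erase_of_ne (fun h : k = j => hL.1 (h ▸ hk))).mpr (hsub k (List.mem_cons_of_mem j hk))
    obtain ⟨ε₂, hε₂, h₂⟩ := ih (l.erase j) hL.2 (hl.erase j) hsub'
    refine ⟨ε₁ * ε₂, ?_, ?_⟩
    · rcases hε₁ with rfl | rfl <;> rcases hε₂ with rfl | rfl <;> norm_num
    · rw [contrList, LinearMap.comp_apply, h₁, map_smul, h₂, smul_smul]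
      congr 2
      rw [hl.erase_eq_filter, List.filter_filter]
      refine List.filter_congr fun k _ => ?_
      by_cases h1 : k = j <;> by_cases h2 : k ∈ L <;> simp [h1, h2]

omit [Fintype ι] in
/-- Iterated contraction along `L` kills a monomial missing some generator of `L`. -/
theorem contrList_mono_eq_zero (L : List (Gen ι)) :
    ∀ l : List (Gen ι), l.Nodup → (∃ j ∈ L, j ∉ l) → contrList L (mono l) = 0 := by
  induction L with
  | nil =>
    intro l _ h
    obtain ⟨j, hj, -⟩ := h
    exact absurd hj (List.not_mem_nil)
  | cons k L ih =>
    intro l hl h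
    obtain ⟨j, hj, hjl⟩ := h
    rw [contrList, LinearMap.comp_apply]
    by_cases hk : k ∈ l
    · obtain ⟨ε, -, hε⟩ := contr_dual_mono_of_mem hl hk
      have hjk : j ≠ k := fun h' => hjl (h' ▸ hk)
      have hj' : j ∈ L := (List.mem_cons.mp hj).resolve_left hjk
      rw [hε, map_smul, ih (l.erase k) (hl.erase k) ⟨j, hj', fun h' => hjl (List.mem_of_mem_erase h')⟩,
        smul_zero]
    · rw [contr_dual_mono_of_notMem hk, map_zero]

omit [DecidableEq ι] in
/-- Every generator index occurs in `genList`. -/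
theorem mem_genList (j : Gen ι) : j ∈ genList := by
  unfold genList
  exact mem_planeList.mpr (Finset.mem_univ _)

omit [DecidableEq ι] in
/-- `genList` is repetition-free. -/
theorem nodup_genList : (genList : List (Gen ι)).Nodup := nodup_planeList _

/-- The integral of a monomial which is a permutation of the full generator list is `±1`. -/
theorem integral_mono_of_forall_mem {l : List (Gen ι)} (hl : l.Nodup) (hall : ∀ j, j ∈ l) :
    ∃ ε : ℂ, (ε = 1 ∨ ε = -1) ∧ integral (mono l) = ε := by
  obtain ⟨ε, hε, h⟩ := contrList_mono_of_subset genList l nodup_genList hl fun j _ => hall j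
  refine ⟨ε, hε, ?_⟩
  have hnil : (l.filter fun k => decide (k ∉ genList)) = [] :=
    List.filter_eq_nil_iff.mpr fun k _ => by simpa using mem_genList k
  rw [integral, LinearMap.comp_apply, h, hnil, mono_nil, map_smul, AlgHom.toLinearMap_apply,
    map_one, smul_eq_mul, mul_one]

/-- The integral of a monomial vanishes unless the monomial is a permutation of the full
generator list: a repeated generator, or a missing one. -/
theorem integral_mono_eq_zero {l : List (Gen ι)} (h : ¬ l.Nodup ∨ ∃ j, j ∉ l) :
    integral (mono l) = 0 := by
  rcases h with h | ⟨j, hj⟩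
  · rw [mono_eq_zero_of_not_nodup h, map_zero]
  · by_cases hl : l.Nodup
    · rw [integral, LinearMap.comp_apply, contrList_mono_eq_zero genList l hl ⟨j, mem_genList j, hj⟩,
        map_zero]
    · rw [mono_eq_zero_of_not_nodup hl, map_zero]

variable (ι) in
/-- `vol := ∫_B E_𝒫` (T4-A3 (A5.3)(b)). -/
noncomputable def vol : ℂ := integral (ET (Finset.univ : Finset ι))

variable (ι) in
/-- `vol = ±1`; in particular `vol ≠ 0`. -/
theorem vol_eq : ∃ ε : ℂ, (ε = 1 ∨ ε = -1) ∧ vol ι = ε := by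
  unfold vol
  rw [ET_eq_mono]
  exact integral_mono_of_forall_mem (nodup_planeList _) fun j => mem_planeList.mpr (Finset.mem_univ _)

variable (ι) in
/-- `vol ≠ 0`. -/
theorem vol_ne_zero : vol ι ≠ 0 := by
  obtain ⟨ε, hε, h⟩ := vol_eq ι
  rw [h]
  rcases hε with rfl | rfl <;> norm_num

end Integral

end Summit.Ventures.HodgeRepro2.WeilIntegral
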